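import Summits.Ventures.PercRepro2.CaseOneCubicI
import Summits.Ventures.PercRepro2.CaseOneTwoMarkMassI

/-!
# `a₃` adjacent exactly to `o` and `b`: the polynomial of `(i)` and its Bernstein form
(blind cell PercRepro2, p1 g15; S5 §2.1 (K9) (o), proofs/P1-TWOMARK.md §7)

`iQpoly r s m` = the cleared `(i)` `D_o·[P(Q)P(Q,A,B₁) − P(Q,B₁)P(Q,A)] − D·[P(Q)P(Q,A,B₁,O₂) −
P(Q,B₁)P(Q,A,O₂)]` with the masses of the class substituted (`r = p_o`, `s = p_b`);
`iExpr_eq_iQpoly` (from `iExpr_eq_probs'` and the mass identities); its `(3,3)`-Bernstein form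
`iQpoly_bern` with the eleven nonzero coefficients `tiB01 … tiB23` (nine times the Bernstein
coefficients; a `ring` identity over any commutative ring). -/

namespace Summit.Ventures.PercRepro2

namespace CaseOne

/-! ## The polynomial `iQ` and its Bernstein form -/

section PolyI
variable {R : Type*} [CommRing R]

/-- **The Q-world polynomial `iQpoly` of `(i)`** for the two-mark class: `D_o·[P(Q)P(Q,A,B₁) − P(Q,B₁)P(Q,A)] −
D·[P(Q)P(Q,A,B₁,O₂) − P(Q,B₁)P(Q,A,O₂)]` with the masses substituted (`r = p_o`, `s = p_b`). -/
def iQpoly (r s : R) (m : TMMasses R) : R :=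
  (1 - r) * (m.oU - s * m.oUbU) *
      ((m.M - r * s * (m.bo₁ + m.ob₁)) *
          (r * (1 - s) * m.o₁b₁ + (1 - r) * s * m.b₁ + r * s * (m.o₁ + m.b₁ - m.o₁b₁ - m.bo₁ - m.ob₁)) -
        (m.b₁ + r * s * (m.o₁ - m.o₁b₁ - m.bo₁ - m.ob₁)) *
          (r * (1 - s) * m.o₁ + (1 - r) * s * m.b₁ + r * s * (m.o₁ + m.b₁ - m.o₁b₁ - m.bo₁ - m.ob₁))) -
    (m.M - r * m.oU - s * m.bU + r * s * m.oUbU) *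
      ((m.M - r * s * (m.bo₁ + m.ob₁)) * ((1 - r) * s * m.ob₁) -
        (m.b₁ + r * s * (m.o₁ - m.o₁b₁ - m.bo₁ - m.ob₁)) * ((1 - r) * s * m.ob₁))

/-- `9 · B^I_{01}`: nine times the `(0,1)` Bernstein coefficient of the Q-world `(i)`. -/
def tiB01 (m : TMMasses R) : R :=
  (3 : R) * m.M * m.b₁ * m.oU + (3 : R) * m.M * m.b₁ * m.ob₁ + (-3 : R) * m.M ^ 2 * m.ob₁ + (-3 : R) * m.b₁ ^ 2 * m.oU
/-- `9 · B^I_{02}`: nine times the `(0,2)` Bernstein coefficient of the Q-world `(i)`. -/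
def tiB02 (m : TMMasses R) : R :=
  (6 : R) * m.M * m.b₁ * m.oU + (-3 : R) * m.M * m.b₁ * m.oUbU + (6 : R) * m.M * m.b₁ * m.ob₁ + (3 : R) * m.M * m.bU * m.ob₁ + (-6 : R) * m.M ^ 2 * m.ob₁ + (-3 : R) * m.b₁ * m.bU * m.ob₁ + (-6 : R) * m.b₁ ^ 2 * m.oU + (3 : R) * m.b₁ ^ 2 * m.oUbU
/-- `9 · B^I_{03}`: nine times the `(0,3)` Bernstein coefficient of the Q-world `(i)`. -/
def tiB03 (m : TMMasses R) : R :=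
  (9 : R) * m.M * m.b₁ * m.oU + (-9 : R) * m.M * m.b₁ * m.oUbU + (9 : R) * m.M * m.b₁ * m.ob₁ + (9 : R) * m.M * m.bU * m.ob₁ + (-9 : R) * m.M ^ 2 * m.ob₁ + (-9 : R) * m.b₁ * m.bU * m.ob₁ + (-9 : R) * m.b₁ ^ 2 * m.oU + (9 : R) * m.b₁ ^ 2 * m.oUbU
/-- `9 · B^I_{10}`: nine times the `(1,0)` Bernstein coefficient of the Q-world `(i)`. -/
def tiB10 (m : TMMasses R) : R :=
  (3 : R) * m.M * m.o₁b₁ * m.oU + (-3 : R) * m.b₁ * m.o₁ * m.oU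
/-- `9 · B^I_{11}`: nine times the `(1,1)` Bernstein coefficient of the Q-world `(i)`. -/
def tiB11 (m : TMMasses R) : R :=
  (2 : R) * m.M * m.b₁ * m.oU + (2 : R) * m.M * m.b₁ * m.ob₁ + (-1 : R) * m.M * m.bo₁ * m.oU + (1 : R) * m.M * m.o₁ * m.oU + (1 : R) * m.M * m.o₁b₁ * m.oU + (-1 : R) * m.M * m.o₁b₁ * m.oUbU + (-2 : R) * m.M ^ 2 * m.ob₁ + (1 : R) * m.b₁ * m.bo₁ * m.oU + (-3 : R) * m.b₁ * m.o₁ * m.oU + (1 : R) * m.b₁ * m.o₁ * m.oUbU + (1 : R) * m.b₁ * m.o₁b₁ * m.oU + (-2 : R) * m.b₁ ^ 2 * m.oU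
/-- `9 · B^I_{12}`: nine times the `(1,2)` Bernstein coefficient of the Q-world `(i)`. -/
def tiB12 (m : TMMasses R) : R :=
  (4 : R) * m.M * m.b₁ * m.oU + (-2 : R) * m.M * m.b₁ * m.oUbU + (4 : R) * m.M * m.b₁ * m.ob₁ + (2 : R) * m.M * m.bU * m.ob₁ + (-2 : R) * m.M * m.bo₁ * m.oU + (1 : R) * m.M * m.bo₁ * m.oUbU + (2 : R) * m.M * m.o₁ * m.oU + (-1 : R) * m.M * m.o₁ * m.oUbU + (1 : R) * m.M * m.o₁ * m.ob₁ + (-1 : R) * m.M * m.o₁b₁ * m.oU + (-1 : R) * m.M * m.o₁b₁ * m.ob₁ + (-4 : R) * m.M ^ 2 * m.ob₁ + (-2 : R) * m.b₁ * m.bU * m.ob₁ + (2 : R) * m.b₁ * m.bo₁ * m.oU + (-1 : R) * m.b₁ * m.bo₁ * m.oUbU + (-4 : R) * m.b₁ * m.o₁ * m.oU + (2 : R) * m.b₁ * m.o₁ * m.oUbU + (3 : R) * m.b₁ * m.o₁b₁ * m.oU + (-1 : R) * m.b₁ * m.o₁b₁ * m.oUbU + (-4 : R) * m.b₁ ^ 2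 * m.oU + (2 : R) * m.b₁ ^ 2 * m.oUbU
/-- `9 · B^I_{13}`: nine times the `(1,3)` Bernstein coefficient of the Q-world `(i)`. -/
def tiB13 (m : TMMasses R) : R :=
  (6 : R) * m.M * m.b₁ * m.oU + (-6 : R) * m.M * m.b₁ * m.oUbU + (6 : R) * m.M * m.b₁ * m.ob₁ + (6 : R) * m.M * m.bU * m.ob₁ + (-3 : R) * m.M * m.bo₁ * m.oU + (3 : R) * m.M * m.bo₁ * m.oUbU + (3 : R) * m.M * m.o₁ * m.oU + (-3 : R) * m.M * m.o₁ * m.oUbU + (3 : R) * m.M * m.o₁ * m.ob₁ + (-3 : R) * m.M * m.o₁b₁ * m.oU + (3 : R) * m.M * m.o₁b₁ * m.oUbU + (-3 : R) * m.M * m.o₁b₁ * m.ob₁ + (-6 : R) * m.M ^ 2 * m.ob₁ + (-6 : R) * m.b₁ * m.bU * m.ob₁ + (3 : R) * m.b₁ * m.bo₁ * m.oU + (-3 : R) * m.b₁ * m.bo₁ * m.oUbU + (-6 : R) * m.b₁ * m.o₁ * m.oU + (6 : R) * m.b₁ * m.o₁ * m.oUbU + (6 : R) * m.b₁ * m.o₁b₁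 * m.oU + (-6 : R) * m.b₁ * m.o₁b₁ * m.oUbU + (-6 : R) * m.b₁ ^ 2 * m.oU + (6 : R) * m.b₁ ^ 2 * m.oUbU + (-3 : R) * m.bU * m.o₁ * m.ob₁ + (3 : R) * m.bU * m.o₁b₁ * m.ob₁
/-- `9 · B^I_{20}`: nine times the `(2,0)` Bernstein coefficient of the Q-world `(i)`. -/
def tiB20 (m : TMMasses R) : R :=
  (3 : R) * m.M * m.o₁b₁ * m.oU + (-3 : R) * m.b₁ * m.o₁ * m.oU
/-- `9 · B^I_{21}`: nine times the `(2,1)` Bernstein coefficient of the Q-world `(i)`. -/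
def tiB21 (m : TMMasses R) : R :=
  (1 : R) * m.M * m.b₁ * m.oU + (1 : R) * m.M * m.b₁ * m.ob₁ + (-1 : R) * m.M * m.bo₁ * m.oU + (1 : R) * m.M * m.o₁ * m.oU + (1 : R) * m.M * m.o₁b₁ * m.oU + (-1 : R) * m.M * m.o₁b₁ * m.oUbU + (-1 : R) * m.M ^ 2 * m.ob₁ + (1 : R) * m.b₁ * m.bo₁ * m.oU + (-3 : R) * m.b₁ * m.o₁ * m.oU + (1 : R) * m.b₁ * m.o₁ * m.oUbU + (1 : R) * m.b₁ * m.o₁b₁ * m.oU + (-1 : R) * m.b₁ ^ 2 * m.oU + (1 : R) * m.bo₁ * m.o₁ * m.oU + (-1 : R) * m.bo₁ * m.o₁b₁ * m.oU + (1 : R) * m.o₁ * m.o₁b₁ * m.oU + (1 : R) * m.o₁ * m.oU * m.ob₁ + (-1 : R) * m.o₁ ^ 2 * m.oU + (-1 : R) * m.o₁b₁ * m.oU * m.ob₁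
/-- `9 · B^I_{22}`: nine times the `(2,2)` Bernstein coefficient of the Q-world `(i)`. -/
def tiB22 (m : TMMasses R) : R :=
  (2 : R) * m.M * m.b₁ * m.oU + (-1 : R) * m.M * m.b₁ * m.oUbU + (2 : R) * m.M * m.b₁ * m.ob₁ + (1 : R) * m.M * m.bU * m.ob₁ + (-2 : R) * m.M * m.bo₁ * m.oU + (1 : R) * m.M * m.bo₁ * m.oUbU + (2 : R) * m.M * m.o₁ * m.oU + (-1 : R) * m.M * m.o₁ * m.oUbU + (1 : R) * m.M * m.o₁ * m.ob₁ + (-1 : R) * m.M * m.o₁b₁ * m.oU + (-1 : R) * m.M * m.o₁b₁ * m.ob₁ + (-2 : R) * m.M ^ 2 * m.ob₁ + (-1 : R) * m.b₁ * m.bU * m.ob₁ + (2 : R) * m.b₁ * m.bo₁ * m.oU + (-1 : R) * m.b₁ * m.bo₁ * m.oUbU + (-4 : R) * m.b₁ * m.o₁ * m.oU + (2 : R) * m.b₁ * m.o₁ * m.oUbU + (3 : R) * m.b₁ * m.o₁b₁ * m.oU + (-1 : R) * m.b₁ * m.o₁b₁ * m.oUbU + (-2 : R) * m.b₁ ^ 2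 * m.oU + (1 : R) * m.b₁ ^ 2 * m.oUbU + (2 : R) * m.bo₁ * m.o₁ * m.oU + (-1 : R) * m.bo₁ * m.o₁ * m.oUbU + (-2 : R) * m.bo₁ * m.o₁b₁ * m.oU + (1 : R) * m.bo₁ * m.o₁b₁ * m.oUbU + (3 : R) * m.o₁ * m.o₁b₁ * m.oU + (-1 : R) * m.o₁ * m.o₁b₁ * m.oUbU + (1 : R) * m.o₁ * m.oU * m.ob₁ + (-1 : R) * m.o₁ * m.oUbU * m.ob₁ + (-2 : R) * m.o₁ ^ 2 * m.oU + (1 : R) * m.o₁ ^ 2 * m.oUbU + (-1 : R) * m.o₁b₁ * m.oU * m.ob₁ + (1 : R) * m.o₁b₁ * m.oUbU * m.ob₁ + (-1 : R) * m.o₁b₁ ^ 2 * m.oU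
/-- `9 · B^I_{23}`: nine times the `(2,3)` Bernstein coefficient of the Q-world `(i)`. -/
def tiB23 (m : TMMasses R) : R :=
  (3 : R) * m.M * m.b₁ * m.oU + (-3 : R) * m.M * m.b₁ * m.oUbU + (3 : R) * m.M * m.b₁ * m.ob₁ + (3 : R) * m.M * m.bU * m.ob₁ + (-3 : R) * m.M * m.bo₁ * m.oU + (3 : R) * m.M * m.bo₁ * m.oUbU + (3 : R) * m.M * m.o₁ * m.oU + (-3 : R) * m.M * m.o₁ * m.oUbU + (3 : R) * m.M * m.o₁ * m.ob₁ + (-3 : R) * m.M * m.o₁b₁ * m.oU + (3 : R) * m.M * m.o₁b₁ * m.oUbU + (-3 : R) * m.M * m.o₁b₁ * m.ob₁ + (-3 : R) * m.M ^ 2 * m.ob₁ + (-3 : R) * m.b₁ * m.bU * m.ob₁ + (3 : R) * m.b₁ * m.bo₁ * m.oU + (-3 : R) * m.b₁ * m.bo₁ * m.oUbU + (-6 : R) * m.b₁ * m.o₁ * m.oU + (6 : R) * m.b₁ * m.o₁ * m.oUbU + (6 : R) * m.b₁ * m.o₁b₁ * m.oU + (-6 : R) * m.b₁ * m.o₁b₁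 * m.oUbU + (-3 : R) * m.b₁ ^ 2 * m.oU + (3 : R) * m.b₁ ^ 2 * m.oUbU + (-3 : R) * m.bU * m.o₁ * m.ob₁ + (3 : R) * m.bU * m.o₁b₁ * m.ob₁ + (3 : R) * m.bo₁ * m.o₁ * m.oU + (-3 : R) * m.bo₁ * m.o₁ * m.oUbU + (-3 : R) * m.bo₁ * m.o₁b₁ * m.oU + (3 : R) * m.bo₁ * m.o₁b₁ * m.oUbU + (6 : R) * m.o₁ * m.o₁b₁ * m.oU + (-6 : R) * m.o₁ * m.o₁b₁ * m.oUbU + (-3 : R) * m.o₁ ^ 2 * m.oU + (3 : R) * m.o₁ ^ 2 * m.oUbU + (-3 : R) * m.o₁b₁ ^ 2 * m.oU + (3 : R) * m.o₁b₁ ^ 2 * m.oUbU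

/-- **The `(3,3)`-Bernstein form of `iQpoly`**: `9 · iQ = Σ C(3,i) C(3,j) rⁱ(1−r)³⁻ⁱ sʲ(1−s)³⁻ʲ · tiBᵢⱼ m`
(the eleven nonzero coefficients; a `ring` identity). -/
theorem iQpoly_bern (r s : R) (m : TMMasses R) :
    9 * iQpoly r s m =
      (3 : R) * r ^ 0 * (1 - r) ^ 3 * s ^ 1 * (1 - s) ^ 2 * tiB01 m +
      (3 : R) * r ^ 0 * (1 - r) ^ 3 * s ^ 2 * (1 - s) ^ 1 * tiB02 m +
      (1 : R) * r ^ 0 * (1 - r) ^ 3 * s ^ 3 * (1 - s) ^ 0 * tiB03 m +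
      (3 : R) * r ^ 1 * (1 - r) ^ 2 * s ^ 0 * (1 - s) ^ 3 * tiB10 m +
      (9 : R) * r ^ 1 * (1 - r) ^ 2 * s ^ 1 * (1 - s) ^ 2 * tiB11 m +
      (9 : R) * r ^ 1 * (1 - r) ^ 2 * s ^ 2 * (1 - s) ^ 1 * tiB12 m +
      (3 : R) * r ^ 1 * (1 - r) ^ 2 * s ^ 3 * (1 - s) ^ 0 * tiB13 m +
      (3 : R) * r ^ 2 * (1 - r) ^ 1 * s ^ 0 * (1 - s) ^ 3 * tiB20 m +
      (9 : R) * r ^ 2 * (1 - r) ^ 1 * s ^ 1 * (1 - s) ^ 2 * tiB21 m +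
      (9 : R) * r ^ 2 * (1 - r) ^ 1 * s ^ 2 * (1 - s) ^ 1 * tiB22 m +
      (3 : R) * r ^ 2 * (1 - r) ^ 1 * s ^ 3 * (1 - s) ^ 0 * tiB23 m := by
  unfold iQpoly tiB01 tiB02 tiB03 tiB10 tiB11 tiB12 tiB13 tiB20 tiB21 tiB22 tiB23
  ring

end PolyI

section Assembly
variable {V : Type*} {E : Type*} [Fintype E] [DecidableEq E] {R : Type*} [Field R]
variable {ends : E → Sym2 V} {o b a₃ : V} {eo eb : E}

/-- **`iExpr` is the polynomial `iQpoly` at the pinned masses** for `a₃ ~ {o, b}`. -/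
theorem iExpr_eq_iQpoly (p : E → R) (h : IsTwoMarkAt ends o b a₃ eo eb) {a₁ a₂ : V} (h1 : a₁ ≠ a₃)
    (h2 : a₂ ≠ a₃) :
    iExpr p ends o a₁ a₂ a₃ b =
      iQpoly (p eo) (p eb) (tmMasses (Function.update (Function.update p eo 0) eb 0) ends o a₁ a₂ b) := by
  rw [iExpr_eq_probs']
  have e1 : connEvent ends a₁ b ∩ connEvent ends a₁ a₃ ∩ connEvent ends a₂ o ∩
      (connEvent ends a₁ a₂)ᶜ =
      (connEvent ends a₁ a₂)ᶜ ∩ connEvent ends a₁ a₃ ∩ connEvent ends a₁ b ∩ connEvent ends a₂ o := by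
    ext ω
    simp only [Set.mem_inter_iff, Set.mem_compl_iff]
    tauto
  have e2 : connEvent ends a₁ b ∩ connEvent ends a₁ a₃ ∩ (connEvent ends a₁ a₂)ᶜ =
      (connEvent ends a₁ a₂)ᶜ ∩ connEvent ends a₁ a₃ ∩ connEvent ends a₁ b := by
    ext ω
    simp only [Set.mem_inter_iff, Set.mem_compl_iff]
    tauto
  have e3 : connEvent ends a₁ b ∩ (connEvent ends a₁ a₂)ᶜ =
      (connEvent ends a₁ a₂)ᶜ ∩ connEvent ends a₁ b := Set.inter_comm _ _
  have e4 : connEvent ends a₁ a₃ ∩ connEvent ends a₂ o ∩ (connEvent ends a₁ a₂)ᶜ =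
      (connEvent ends a₁ a₂)ᶜ ∩ connEvent ends a₁ a₃ ∩ connEvent ends a₂ o := by
    ext ω
    simp only [Set.mem_inter_iff, Set.mem_compl_iff]
    tauto
  have e5 : connEvent ends a₁ a₃ ∩ (connEvent ends a₁ a₂)ᶜ =
      (connEvent ends a₁ a₂)ᶜ ∩ connEvent ends a₁ a₃ := Set.inter_comm _ _
  rw [prob_congr_set p e1, prob_congr_set p e2, prob_congr_set p e3, prob_congr_set p e4,
    prob_congr_set p e5, prob_QAB1O_twoMark p h h1 h2, prob_QAB1_twoMark p h h1 h2,
    prob_QB1_twoMark p h h1 h2, prob_QAO_twoMark p h h1 h2, prob_QA_twoMark p h h1 h2,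
    prob_Q_twoMark p h h1 h2, Dpd_twoMark p h h1 h2, Dpdo_twoMark p h h1 h2]
  unfold iQpoly tmMasses
  ring

end Assembly

end CaseOne

end Summit.Ventures.PercRepro2
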